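import Literature.MathematicalPhysics.QuantumFieldTheory.Balaban1983to89.B11Eq115Space
import Literature.MathematicalPhysics.QuantumFieldTheory.Balaban1983to89.B11Prop6Scheme

/-!
# `Balaban1983to89.B11Eq44QuadLetter` — T. Bałaban, *The variational problem and background fields in renormalization group method for
lattice gauge theories*, Commun. Math. Phys. **102** (1985) 277–309 [Balaban1985Variational], Sect. C p. 285 (44)/(52) and Sect. D p. 293
(98): **THE QUADRATIC-ANALYTIC LETTERS BETWEEN THE CARRIERS OF (115)** — a NONLINEAR map given block by block on the lattice functions
(print's `C_j(L^jη ·)` of (44), `(δ/δA′)V` of (98)), read between lit-balaban's typed carriers `B11Eq115Space.JetSup` (the space (115)) and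
`B11Eq115Space.NegSup` (the sizes `|·|_{(−n)}`): LOCAL WEIGHTED QUADRATIC BOUND ⟹ the bound `‖F(A)‖ ≤ K‖A‖²` on a ball, blockwise analyticity
⟹ analyticity on the ball, packaged as lit-balaban's hypothesis structures `B11Prop6Scheme.Prop4Hyp` / `B13Contraction113.QuadAnalytic`
(the `quad` slot of `B11Eq174Chart.Regime`)

statement-level skeleton of published theorems with citation tags; proofs where landed; nothing here is a claim about the Yang–Mills mass gap

PDF held: `paper:balaban1985-cmp102-variational-background` (journal page = PDF page + 276); p. 285 (44)–(52) read on the render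
`pub-balaban/b2b-balaban-ref1/pages/1985-cmp102-variational-background/1985-cmp102-variational-background-p009-x2.png` (AS AN IMAGE, this seat,
2026-08-21); p. 286 (53)–(57), p. 293 (97)–(98) from the text layer and lit-balaban's verbatim quotations (`B13Contraction113`, `B11Prop6Scheme`).

THE PRINT (verbatim, p. 285): *«The Proposition 4 of [4] implies Q_j(ηA) = LʲηQ_jA + C_j(LʲηA), |C_j(LʲηA)| ≦ C₂(Lʲη)²|A|². (44) … Thus the
function D(A′) is a fixed point of the transformation X → C_j(LʲηA′ − LʲηHX) on Λ_j, j = 0, 1, …, k. (50) We consider configurations A′, X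
with values in the complexified Lie algebra gᶜ, and satisfying |A′| < ε₃(Lʲη)⁻¹ on Ω_j, X = 0 on Λ₀, |X| < ε₃/B₀ on 𝔅_k. (51) The
transformation (50) calculated at such configurations satisfies |C_j(LʲηA′ − LʲηHX)| ≦ C₂(Lʲη|A′| + Lʲη|HX|)² < 4C₂ε₃², (52)»*; p. 293:
*«The functional derivative of V(A′) is an analytic function on this space, and satisfies the estimate … (98)»* (as quoted in `B11Prop6Scheme`).

WHY THIS FILE (cell context; INTERFACE, not an estimate).  The pub-balaban NE9 chain consumes Sect. C through lit-balaban's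
`B13Contraction113.QuadAnalytic C C₂ c₄` (the `quad` field of the Sect. C `B11Eq174Chart.Regime H 0 C b 0 C₂ c₄ 0 a_C ε_C`) and the analyticity letter
`hCa : AnalyticOnNhd ℂ C {‖Y‖ < c₄}` (`Summits/…/NE9B11ChartAnalytic.chart47_spec`), for a map `C : Space115 L η lev₀ lev₁ ∇ → NegSize L η levB 0 V`
between the CARRIERS typed by the NE9 row owner (`B11Eq115Space`, (L1) of INTERFACE REQUEST NE9).  Print GIVES `C` (and `(δ/δA′)V`) block by
block on the lattice functions with a POINTWISE weighted bound ((44): the value at a block of level `j` is `≤ C₂·(Lʲη·sup|A|)²`; (98): the value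
at a bond times `(Lʲη)³` is `≤ C₄(…)²`).  This file is the [folklore] plumbing from the pointwise shape to the carrier-typed letters — the
nonlinear twin of `B11Eq115KernelOp` (KERNEL BOUND ⟹ OPERATOR BOUND) —, generic over index types, fibres and weights; the CONCRETE `C` of the
one-step averaging on the periodic lattice is the sequel `B11Eq44COperatorTorus`.

WHAT IS DEFINED AND PROVED (sorry-free; no `Prop` placeholder; no inequality of the paper asserted).
* §1 `quadOf w₀ w₁ ∇ w′ F : JetSup w₀ w₁ ∇ → NegSup w′ V′` — the letter of a block map `F : (ι → V) → (β → V′)` (values read through the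
  identifications `JetSup.equiv` / `NegSup.equiv`); `equiv_quadOf_apply` (rfl), `quadOf_zero` (`F 0 = 0 ⇒ quadOf F 0 = 0`).
* §2 **`norm_quadOf_le_sq`** — LOCAL WEIGHTED QUADRATIC BOUND ⟹ QUADRATIC BOUND OF THE LETTER: if every weighted block value of `F f` is
  `≤ K·r²` whenever the weighted sizes of `f` and `∇f` are pointwise `≤ r` with `0 ≤ r < c`, then `‖quadOf F A‖ ≤ K‖A‖²` for `‖A‖ < c`
  (take `r := ‖A‖`: the pointwise data ARE the (115) norm, `JetSup.weight_mul_norm_apply_le` / `weight_mul_norm_deriv_le`).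
* §3 `jetFlat` (the flat reading `JetSup w₀ w₁ ∇ →L[𝕜] (ι → V)`), `quadOf_eq_comp`; **`analyticAt_quadOf`** / **`analyticOnNhd_quadOf`** —
  blockwise Fréchet analyticity of `F` at the flat point ⟹ analyticity of the letter (composition with the continuous linear identifications;
  `analyticAt_pi_iff`); `differentiableOn_quadOf`.
* §4 (`𝕜 = ℂ`) **`prop4Hyp_quadOf : Prop4Hyp (quadOf … F) K c`** and **`quadAnalytic_quadOf : QuadAnalytic (quadOf … F) K c`** — the two
  hypothesis structures of lit-balaban's contraction scheme DISCHARGED from the two pointwise hypotheses.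
MODEL READINGS.  Index types `ι` (points of `A`), `κ` (points of `∇A`), `β` (blocks / points of the values) are finite types; weights positive
(`Fact`); the fibres `V`, `V′` any normed `𝕜`-spaces.  At print's weights `levWeight L η lev n` the letter is
`Space115 L η lev₀ lev₁ ∇ → NegSize L η levB n V′` (n = 0: the `C` of (44)/(50) valued on 𝔅_k; n = 3: the `(δ/δA′)V` of (98) valued in |·|_{(−3)}).
HONEST SCOPE.  [folklore] bookkeeping; NOT summit progress (cell pub-balaban: NE9 NOT PRINTED / NOT PROVED; spine PROVED 0/9; rung (B)+1 on a
finite T⁴ — NOT infinite volume, NOT mass gap, NOT Clay).  Filed by the pub-balaban NE9 crux-team leaf seat `b2b-balaban-t4-ne9-formalise-leaf-03`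
(gen 54) on the NE9 refuter's request «type (L5) `Cc` at the carrier as a `Regime` slot» (PRICING-NE9 v20); NEW file, nothing modified.
Net new unproved facts: 0.
-/

noncomputable section

namespace Literature.MathematicalPhysics.QuantumFieldTheory.Balaban1983to89.B11Eq44QuadLetter

open Metric Set
open Literature.MathematicalPhysics.QuantumFieldTheory.Balaban1983to89.B11Eq115Space
open Literature.MathematicalPhysics.QuantumFieldTheory.Balaban1983to89.B13Contraction113 (QuadAnalytic)
open Literature.MathematicalPhysics.QuantumFieldTheory.Balaban1983to89.B11Prop6Scheme (Prop4Hyp)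

variable {𝕜 : Type*} [NontriviallyNormedField 𝕜] {ι κ β : Type*} {V V' : Type*} [NormedAddCommGroup V] [NormedSpace 𝕜 V]
  (w₀ : ι → ℝ) (w₁ : κ → ℝ) (D : (ι → V) →ₗ[𝕜] (κ → V)) (w' : β → ℝ)

/-! ## §1 The letter of a nonlinear block map -/

/-- **The letter of a block map between the carriers**: for `F : (ι → V) → (β → V′)` given on the lattice functions (print's
`A ↦ (C_j(LʲηA))_{block}` of (44)/(50), `A′ ↦ (δ/δA′)V(A′)` of (98)), the same map read from the space (115) `JetSup w₀ w₁ ∇` to the size space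
`NegSup w′ V′`. [cite: Balaban1985Variational, (44) p.285, (50) p.285, (98) p.293] -/
def quadOf (F : (ι → V) → β → V') : JetSup w₀ w₁ D → NegSup w' V' :=
  fun A => (NegSup.equiv w' V').symm (F (JetSup.equiv w₀ w₁ D A))

/-- Its values are `F`'s (by `rfl`). [cite: Balaban1985Variational, (44) p.285] -/
@[simp] theorem equiv_quadOf_apply (F : (ι → V) → β → V') (A : JetSup w₀ w₁ D) (y : β) :
    NegSup.equiv w' V' (quadOf w₀ w₁ D w' F A) y = F (JetSup.equiv w₀ w₁ D A) y := rfl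

section Zero

variable [NormedAddCommGroup V']

/-- A block map vanishing at `0` gives a letter vanishing at `0` (print: `C_j`, `D`, `(δ/δA′)V` have no constant term —
«a power series expansion of D(A′) begins with second order terms», p. 286). [cite: Balaban1985Variational, (55) p.286] -/
theorem quadOf_zero {F : (ι → V) → β → V'} (hF : F 0 = 0) : quadOf w₀ w₁ D w' F 0 = 0 := by
  show (NegSup.equiv w' V').symm (F (JetSup.equiv w₀ w₁ D 0)) = 0
  rw [JetSup.equiv_zero, hF]
  rfl

end Zero

/-! ## §2 Local weighted quadratic bound ⟹ quadratic bound of the letter -/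

section Carrier

variable [Fintype ι] [Fintype κ] [Fintype β] [Fact (∀ i, 0 < w₀ i)] [Fact (∀ p, 0 < w₁ p)] [Fact (∀ y, 0 < w' y)]
  [NormedAddCommGroup V']

/-- **LOCAL WEIGHTED QUADRATIC BOUND ⟹ `‖F(A)‖ ≤ K‖A‖²` ON THE BALL** (the shape of (44)/(52): «|C_j(LʲηA′ …)| ≦ C₂(Lʲη|A′| + …)²» from
the POINTWISE data «|A′| < ε₃(Lʲη)⁻¹ on Ω_j» of (51); of (98) likewise).  Hypothesis: whenever the weighted sizes `w₀(x)‖f(x)‖` and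
`w₁(p)‖(∇f)(p)‖` are all `≤ r` with `0 ≤ r < c`, every weighted block value satisfies `w′(y)‖F f y‖ ≤ K·r²`.  Conclusion: on `‖A‖ < c`
the letter is bounded by `K‖A‖²` — with `r := ‖A‖`, the pointwise data being exactly the norm of (115). [cite: Balaban1985Variational, (44) p.285, (51)–(52) p.285, (98) p.293] -/
theorem norm_quadOf_le_sq {F : (ι → V) → β → V'} {K c : ℝ} (hK : 0 ≤ K)
    (hF : ∀ (f : ι → V) (r : ℝ), 0 ≤ r → r < c → (∀ x, w₀ x * ‖f x‖ ≤ r) → (∀ p, w₁ p * ‖D f p‖ ≤ r) →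
      ∀ y, w' y * ‖F f y‖ ≤ K * r ^ 2)
    {A : JetSup w₀ w₁ D} (hA : ‖A‖ < c) : ‖quadOf w₀ w₁ D w' F A‖ ≤ K * ‖A‖ ^ 2 :=
  (NegSup.norm_le_iff (by positivity)).2 fun y =>
    hF _ ‖A‖ (norm_nonneg A) hA (JetSup.weight_mul_norm_apply_le A) (JetSup.weight_mul_norm_deriv_le A) y

/-! ## §3 Blockwise analyticity ⟹ analyticity of the letter -/

variable [NormedSpace 𝕜 V']

/-- The flat reading of the space (115) as a continuous linear map `JetSup w₀ w₁ ∇ →L[𝕜] (ι → V)` (pointwise evaluations).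
[cite: Balaban1985Variational, (115) p.294] -/
def jetFlat : JetSup w₀ w₁ D →L[𝕜] (ι → V) :=
  ContinuousLinearMap.pi fun x => JetSup.evalCLM w₀ w₁ D x

/-- Unfolding: `jetFlat A = A` read as a function (by `rfl`). [cite: Balaban1985Variational, (115) p.294] -/
@[simp] theorem jetFlat_apply (A : JetSup w₀ w₁ D) : jetFlat w₀ w₁ D A = JetSup.equiv w₀ w₁ D A := rfl

/-- The letter IS «identification⁻¹ ∘ F ∘ flat reading». [cite: Balaban1985Variational, (44) p.285] -/
theorem quadOf_eq_comp (F : (ι → V) → β → V') :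
    quadOf w₀ w₁ D w' F = (NegSup.continuousLinearEquiv 𝕜 w' (V := V')).symm ∘ F ∘ jetFlat w₀ w₁ D := by
  funext A
  apply (NegSup.continuousLinearEquiv 𝕜 w' (V := V')).injective
  rw [Function.comp_apply, Function.comp_apply, ContinuousLinearEquiv.apply_symm_apply]
  rfl

/-- **BLOCKWISE ANALYTICITY ⟹ ANALYTICITY OF THE LETTER at a point**: if every block value `f ↦ F f y` is analytic at the flat point of `A`
(print: «analytic function of A′», p. 286; «The functional derivative of V(A′) is an analytic function on this space», p. 292), the letter is
analytic at `A` (finite products: `analyticAt_pi_iff`; the identifications are continuous linear). [cite: Balaban1985Variational, p.286, Prop. 4 p.292] -/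
theorem analyticAt_quadOf {F : (ι → V) → β → V'} {A : JetSup w₀ w₁ D}
    (hF : ∀ y, AnalyticAt 𝕜 (fun f : ι → V => F f y) (JetSup.equiv w₀ w₁ D A)) :
    AnalyticAt 𝕜 (quadOf w₀ w₁ D w' F) A := by
  have h1 : AnalyticAt 𝕜 (fun f : ι → V => fun y => F f y) (jetFlat w₀ w₁ D A) := analyticAt_pi_iff.2 hF
  rw [quadOf_eq_comp (𝕜 := 𝕜)]
  exact ((NegSup.continuousLinearEquiv 𝕜 w' (V := V')).symm.analyticAt _).comp (h1.comp ((jetFlat w₀ w₁ D).analyticAt A))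

/-- **… on the ball**: blockwise analyticity at every flat point whose weighted sizes are `< c` ⟹ the letter is analytic on `{‖A‖ < c}`
(the pointwise data of the ball, `JetSup.norm_lt_iff_pointwise`). [cite: Balaban1985Variational, p.286, Prop. 4 p.292, (115) p.294] -/
theorem analyticOnNhd_quadOf {F : (ι → V) → β → V'} {c : ℝ}
    (hF : ∀ f : ι → V, (∀ x, w₀ x * ‖f x‖ < c) → (∀ p, w₁ p * ‖D f p‖ < c) → ∀ y, AnalyticAt 𝕜 (fun g : ι → V => F g y) f) :
    AnalyticOnNhd 𝕜 (quadOf w₀ w₁ D w' F) {A | ‖A‖ < c} := fun A hA => by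
  have hc : 0 < c := (norm_nonneg A).trans_lt hA
  obtain ⟨h0, h1⟩ := (JetSup.norm_lt_iff_pointwise hc).1 (hA : ‖A‖ < c)
  exact analyticAt_quadOf w₀ w₁ D w' (hF _ h0 h1)

/-- … hence complex- (`𝕜`-) differentiable on the ball. [cite: Balaban1985Variational, p.286, Prop. 4 p.292] -/
theorem differentiableOn_quadOf {F : (ι → V) → β → V'} {c : ℝ}
    (hF : ∀ f : ι → V, (∀ x, w₀ x * ‖f x‖ < c) → (∀ p, w₁ p * ‖D f p‖ < c) → ∀ y, AnalyticAt 𝕜 (fun g : ι → V => F g y) f) :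
    DifferentiableOn 𝕜 (quadOf w₀ w₁ D w' F) {A | ‖A‖ < c} :=
  (analyticOnNhd_quadOf w₀ w₁ D w' hF).differentiableOn

end Carrier

/-! ## §4 The two hypothesis structures of lit-balaban's contraction scheme, discharged from the pointwise data -/

section Structures

variable {ι κ β : Type*} [Fintype ι] [Fintype κ] [Fintype β] {V V' : Type*} [NormedAddCommGroup V] [NormedSpace ℂ V]
  [NormedAddCommGroup V'] [NormedSpace ℂ V'] (w₀ : ι → ℝ) (w₁ : κ → ℝ) (D : (ι → V) →ₗ[ℂ] (κ → V)) (w' : β → ℝ)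
  [Fact (∀ i, 0 < w₀ i)] [Fact (∀ p, 0 < w₁ p)] [Fact (∀ y, 0 < w' y)]

/-- **`Prop4Hyp` OF THE LETTER** (lit-balaban's Fréchet form of Prop. 4's two clauses, `B11Prop6Scheme.Prop4Hyp W C₄ a₃`: the quadratic bound on
`‖Y‖ < a₃` and `DifferentiableOn ℂ` there) from the local weighted quadratic bound and blockwise analyticity.
[cite: Balaban1985Variational, Prop. 4 (97)–(98) pp.292–293, (44) p.285] -/
theorem prop4Hyp_quadOf {F : (ι → V) → β → V'} {K c : ℝ} (hK : 0 ≤ K)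
    (hFb : ∀ (f : ι → V) (r : ℝ), 0 ≤ r → r < c → (∀ x, w₀ x * ‖f x‖ ≤ r) → (∀ p, w₁ p * ‖D f p‖ ≤ r) →
      ∀ y, w' y * ‖F f y‖ ≤ K * r ^ 2)
    (hFa : ∀ f : ι → V, (∀ x, w₀ x * ‖f x‖ < c) → (∀ p, w₁ p * ‖D f p‖ < c) → ∀ y, AnalyticAt ℂ (fun g : ι → V => F g y) f) :
    Prop4Hyp (quadOf w₀ w₁ D w' F) K c :=
  ⟨fun _ hY => norm_quadOf_le_sq w₀ w₁ D w' hK hFb hY, differentiableOn_quadOf w₀ w₁ D w' hFa⟩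

/-- **`QuadAnalytic` OF THE LETTER** — THE `quad` SLOT of `B11Eq174Chart.Regime` (lit-balaban's `B13Contraction113.QuadAnalytic C C₂ R`: the
bound on `‖Y‖ < R` + analyticity along complex lines, «what the Cauchy formula (53) consumes») from the same two pointwise hypotheses.
[cite: Balaban1985Variational, (44) p.285, (49)–(55) pp.285–286] -/
theorem quadAnalytic_quadOf {F : (ι → V) → β → V'} {K c : ℝ} (hK : 0 ≤ K)
    (hFb : ∀ (f : ι → V) (r : ℝ), 0 ≤ r → r < c → (∀ x, w₀ x * ‖f x‖ ≤ r) → (∀ p, w₁ p * ‖D f p‖ ≤ r) →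
      ∀ y, w' y * ‖F f y‖ ≤ K * r ^ 2)
    (hFa : ∀ f : ι → V, (∀ x, w₀ x * ‖f x‖ < c) → (∀ p, w₁ p * ‖D f p‖ < c) → ∀ y, AnalyticAt ℂ (fun g : ι → V => F g y) f) :
    QuadAnalytic (quadOf w₀ w₁ D w' F) K c :=
  (prop4Hyp_quadOf w₀ w₁ D w' hK hFb hFa).quadAnalytic

end Structures


end Literature.MathematicalPhysics.QuantumFieldTheory.Balaban1983to89.B11Eq44QuadLetter

end
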